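import Summits.Parity.GeneralizedHardyLittlewood.Theorems.LeeYangFibresCellParityLawKernelDefs
import HarnessLib

/-!
# Route `LeeYangFibres`, crux `CellParityLaw` (stmt-Parity-14109), line `section-annihilator`:
# the kernel reshaped — Buchstab recursion over the least prime factor reduces the effective
# rough-cell law to an effective Bombieri `P₂` law (skeleton v18 vocabulary)

Route-posited objects and statement types (D-0016 `<Route><Crux>…Defs` file; companion of
`LeeYangFibresCellParityLawKernelDefs.lean`). NOTHING IS ASSERTED: every `def … : Prop` is the type of a
registered stub of skeleton v18 (`Cruxes/CellParityLaw/Lines/section_annihilator.lean`, continuation lead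
`prover-line-stmt-Parity-14109-c5-0`), and the only theorem is bookkeeping in those
statements (`stub_geThreeComposeStrong`, pure logic).

## Why (lead c5, 2026-08-16)

After v17 the crux is closed modulo the atom `stub_sectionLevel` and the kernel
`stub_roughCellKernel : EffectiveRoughCellLaw` (the effective, polynomial-rate Bombieri law for ALL rough
`Ω`-cells `C_m`, `m ≥ 1`, of one sifted sequence at finite level). v18 splits the kernel along the exact
Buchstab recursion over the least prime factor,

  `C_{m+1}(𝒜; x, z) = Σ_{z < p} C_m(𝒜_p; x/p, p⁻)`   (`𝒜_p` = the fibre `m ↦ a_{pm}`, `RecursionIdentity`),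

which is a bijection `q ↔ (P⁻(q), q/P⁻(q))` and loses nothing. Since the fibres of kernel-admissible data are
again kernel-admissible ON AVERAGE (`FibreInheritance`: weights, support, counting-function size and density are
inherited verbatim, and the STRONG Type-I bounds `Σ_d sup_y |r_d(y)|` of the fibres sum to
`≪ (log x)^{A₃}(R + x/z)`), the `m`-cell law for `𝒜` follows from the `(m-1)`-cell laws of the fibres — each
with ITS OWN parity parameter `δ_p`, pinned by the fibre's prime count — plus ONE coherence statement linking the
fibres' prime counts to the parent's: with `T = e^γ V(z) A(x)/u'` (`primeMain`),

  `Σ_{z < p ≤ q, pq ≤ x} a_{pq} I_m(log(x/p)/log p) = I_{m+1}(u') (2T − Σ_p a_p) ± error`   (`EffectiveWeightedP2Law`),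

which is exactly Bombieri's `P₂` law ([BombieriRIMS1977] p. 5, case `r = 2`; tree
`Literature.NumberTheory.Sieve.Bombieri1976_P2Distribution`, PROVED there qualitatively at level `1` for one
sequence) for the Buchstab test functions `G_m(β) = I_m((1-β)/β)·1_{β > 1/u'}` (`∫ G_m dβ/(β(1-β)) = I_{m+1}(u')`
is `roughCellDensity_succ`), made EFFECTIVE (rate in the level deficit `η`) and UNIFORM over the admissible
class. So the research content of the kernel is not "all `Ω`-cells" but the effective `P₂` law alone; its first
instance (`m = 1`, `u' ∈ (2,3]`) is lead c4's two-cell identity `C₁ + C₂/log(u'-1) = 2T`. The remaining inputs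
are provable now: the linear-sieve upper bound for the primes of the sequence (`PrimeUpperBound`, Iwaniec 1980,
tree `Iwaniec1980_thm1_upper_of_half_lt`), the model prime sum with rate (`ModelPrimeSum`, two-sided Mertens +
Abel summation + `roughCellDensity_succ`), and the induction (`KernelInduction`).

The target of the induction is `EffectiveRoughCellLawStrong`: the landed kernel's conclusion for every
threshold `z ∈ [x^{1/(u+1)}, x^{1/2}]`, WITHOUT the size lower bound (an explicit junk allowance `x/z` instead)
and with the Type-I hypothesis in Bombieri–Friedlander–Iwaniec's printed (A₂) shape `Σ_d sup_{y ≤ x} |r_d(y)|`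
(`StrongTypeI`; the landed `EffectiveRoughCellLaw` has `sup_y Σ_d`, which fibres do not inherit linearly — lead
c3's `KERNEL-NOTES-c3.md` §4). The crux-side glue absorbs the change: `GeThreeReduceStrong` replaces
`GeThreeReduce`, converting the atom's body-by-body bound into the strong shape by a grid/covering argument
(`CoveringInequality`: `Σ_d sup_y |r_d| ≤ (Y+2) sup_y Σ_d |r_d| + C (x/Y + x^{1-η})(log x)^{A₃}`), affordable
because the atom saves every power of `log N`.

References: E. Bombieri, RIMS Kôkyûroku 294 (1977) p. 5 [BombieriRIMS1977]; E. Bombieri, Rend. Accad. Naz. XL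
(5) 1/2 (1975/76) [BombieriAsymptoticSieve1976]; J. Friedlander, H. Iwaniec, Ann. Sc. Norm. Sup. Pisa (4) 5
(1978) §4 [FriedlanderIwaniecPisa1978]; H. Iwaniec, Acta Arith. 36 (1980) Thm 1 [IwaniecActaArith1980];
K. Alladi, Quart. J. Math. 33 (1982) [Alladi1982].
-/

noncomputable section

open scoped BigOperators Classical
open Finset Literature.NumberTheory.Sieve

namespace Summit.Parity.GeneralizedHardyLittlewood.Cruxes.CellParityLaw.SectionAnnihilator

/-! ## Fibre sequences, strong Type-I data, admissibility -/

/-- **The fibre of a sifted sequence over `p`** (`𝒜_p`): weights `m ↦ a_{pm}`, size = its own counting function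
`y ↦ Σ_{m ≤ y} a_{pm} = A_p(py)`, the same multiplicative density `g`. -/
def fibreSeq (𝒜 : SieveSequence) (p : ℕ) : SieveSequence where
  a m := 𝒜.a (p * m)
  a_nonneg _ := 𝒜.a_nonneg _
  size y := ∑ m ∈ Finset.Ioc 0 ⌊y⌋₊, 𝒜.a (p * m)
  density := 𝒜.density
  density_mult := 𝒜.density_mult

/-- **Strong Type-I bound at level `x^{1-η}`** (`StrongTypeI 𝒜 x η R`): Bombieri–Friedlander–Iwaniec's (A₂) shape
`Σ_{d ≤ x^{1-η}, d squarefree} sup_{y ≤ x} |A_d(y) − g(d) A(y)| ≤ R`, the supremum written (free of `iSup` junk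
values) as a bound uniform over all selections `y_d ≤ x` (cf. `SieveSequence.BombieriA2At`). -/
def StrongTypeI (𝒜 : SieveSequence) (x η R : ℝ) : Prop :=
  ∀ y : ℕ → ℝ, (∀ d, y d ≤ x) →
    ∑ d ∈ (Finset.Icc 1 ⌊x ^ (1 - η)⌋₊).filter Squarefree, |𝒜.remainder d (y d)| ≤ R

/-- **Kernel-admissible data** (`KernelAdmissible A₁ L' 𝒜 x η Λ w₀ R`): the hypotheses of the kernel on the
sequence — weights `0 ≤ a_q ≤ 1` supported on `(x/Λ, x]`; size = counting function; multiplicative density with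
`g(p) ≤ A₁/p`, Iwaniec dimension `Ω(1, L')` and the two-sided Mertens bound
`∏_{w ≤ p < z'} (1-g(p))⁻¹ ≥ (log z'/log w)(1 − L'/log w)` for `w₀ ≤ w ≤ z' ≤ x`; strong Type-I bound `R` at level
`x^{1-η}`. (No size lower bound: junk is charged to the error `x/z`.) -/
def KernelAdmissible (A₁ L' : ℝ) (𝒜 : SieveSequence) (x η Λ w₀ R : ℝ) : Prop :=
  (∀ q : ℕ, 𝒜.a q ≤ 1) ∧ (∀ q : ℕ, x < (q : ℝ) → 𝒜.a q = 0) ∧ (∀ q : ℕ, (q : ℝ) ≤ x / Λ → 𝒜.a q = 0) ∧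
  (∀ y : ℝ, 𝒜.size y = 𝒜.congrSum 1 y) ∧
  (∀ p : ℕ, p.Prime → 𝒜.density p ≤ A₁ / p) ∧ HasIwaniecDimension 𝒜.density 1 L' ∧
  (∀ w z' : ℝ, w₀ ≤ w → w ≤ z' → z' ≤ x →
      Real.log z' / Real.log w * (1 - L' / Real.log w) ≤
        ∏ p ∈ (Nat.primesBelow ⌈z'⌉₊).filter (fun p : ℕ => w ≤ (p : ℝ)), (1 - 𝒜.density p)⁻¹) ∧
  StrongTypeI 𝒜 x η R

/-- **Parameter ranges of the kernel** (`KernelRanges x η Λ w₀ η₀`): level deficit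
`(log x)^{-1/2} ≤ η ≤ η₀`, support parameter `1 ≤ Λ ≤ x^η`, small-prime cut `2 ≤ w₀ ≤ x^η`. -/
def KernelRanges (x η Λ w₀ η₀ : ℝ) : Prop :=
  Real.log x ^ (-(1 / 2 : ℝ)) ≤ η ∧ η ≤ η₀ ∧ 1 ≤ Λ ∧ Λ ≤ x ^ η ∧ 2 ≤ w₀ ∧ w₀ ≤ x ^ η

/-- **The prime scale** `T(𝒜; x, z) = e^γ V(z) A(x) / u'`, `u' = log x/log z`, `V(z) = ∏_{p<z} (1 − g(p))`: the
expected number of primes of the sequence (two-sided Mertens: `≈ H A(x)/log x`, independent of `z`). The kernel's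
model for the cell `m` is `(1 + (δ−1)(−1)^m) I_m(u') T`. -/
def primeMain (𝒜 : SieveSequence) (x z : ℝ) : ℝ :=
  Real.exp Real.eulerMascheroniConstant * 𝒜.densityProduct (primesProdBelow z) * 𝒜.size x /
    (Real.log x / Real.log z)

/-- **The kernel's error currency** `kernelErr C κ A₂ 𝒜 x z η Λ R
 = C (η^κ + (log z)^{-κ} + log(2Λ)/log z) V(z) A(x) + C (log x)^{A₂} (R + x/z)`
(rate in the deficit, Mertens/Buchstab rate, localisation cost; Type-I bound and junk `x/z`). -/
def kernelErr (C κ : ℝ) (A₂ : ℕ) (𝒜 : SieveSequence) (x z η Λ R : ℝ) : ℝ :=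
  C * (η ^ κ + Real.log z ^ (-κ) + Real.log (2 * Λ) / Real.log z) *
      (𝒜.densityProduct (primesProdBelow z) * 𝒜.size x) +
    C * Real.log x ^ A₂ * (R + x / z)

/-! ## The reshaped kernel and its target -/

/-- **Effective rough-cell law, strong Type-I form** (`EffectiveRoughCellLawStrong`; conclusion of
`KernelInduction`, consumed by `GeThreeReduceStrong`): for every `u ≥ 2, A₁, L'` there are `κ > 0`, `C`, `η₀ > 0`,
`A₂`, `x₀` such that for all kernel-admissible data with `x ≥ x₀`, `z ∈ [x^{1/(u+1)}, x^{1/2}]` and parameters in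
range, ONE `δ ∈ [0, 2]` gives, for every `m ≥ 1`,
`|C_m(𝒜; x, z) − (1 + (δ−1)(−1)^m) I_m(u') T| ≤ kernelErr`. Compared with the landed `EffectiveRoughCellLaw`:
thresholds up to `x^{1/2}`, no size lower bound (junk `x/z` in the error), Type-I in the (A₂) shape
`Σ_d sup_y`. -/
def EffectiveRoughCellLawStrong : Prop :=
  ∀ (u : ℕ) (A₁ L' : ℝ), 2 ≤ u → ∃ (κ C η₀ : ℝ) (A₂ : ℕ) (x₀ : ℝ), 0 < κ ∧ 0 ≤ C ∧ 0 < η₀ ∧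
    ∀ (𝒜 : SieveSequence) (x z η Λ w₀ R : ℝ), x₀ ≤ x →
      x ^ (1 / ((u : ℝ) + 1)) ≤ z → z ≤ x ^ (1 / 2 : ℝ) →
      KernelRanges x η Λ w₀ η₀ → KernelAdmissible A₁ L' 𝒜 x η Λ w₀ R →
      ∃ δ : ℝ, 0 ≤ δ ∧ δ ≤ 2 ∧ ∀ m : ℕ, 1 ≤ m →
        |roughCellSum 𝒜 x z m -
            (1 + (δ - 1) * (-1 : ℝ) ^ m) * roughCellDensity m (Real.log x / Real.log z) * primeMain 𝒜 x z|
          ≤ kernelErr C κ A₂ 𝒜 x z η Λ R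

/-- **Buchstab-weighted rough pair sums** `weightedPairSum 𝒜 x z j
 = Σ_{q ≤ x, Ω(q) = 2, P⁻(q) > z} a_q · I_j(log(x/P⁻(q))/log P⁻(q))`: the rough `P₂`-part of the sequence tested
against the Buchstab test function of order `j` in the least prime factor (`j = 1`: the plain rough `P₂` cell,
since `I_1 = 1` on `[1, ∞)`). -/
def weightedPairSum (𝒜 : SieveSequence) (x z : ℝ) (j : ℕ) : ℝ :=
  ∑ q ∈ (Finset.Ioc 0 ⌊x⌋₊).filter
      (fun q : ℕ => z < (Nat.minFac q : ℝ) ∧ ArithmeticFunction.cardFactors q = 2),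
    𝒜.a q * roughCellDensity j (Real.log (x / (Nat.minFac q : ℝ)) / Real.log (Nat.minFac q : ℝ))

/-- **Effective weighted `P₂` law** (`EffectiveWeightedP2Law`; type of the KERNEL stub `stub_weightedP2Law` of
skeleton v18 — the research content of the crux's kernel after the Buchstab reshape): for every `u ≥ 2, A₁, L'`
there are `κ > 0`, `C`, `η₀ > 0`, `A₂`, `x₀` such that for all kernel-admissible data with `x ≥ x₀`,
`z ∈ [x^{1/(u+1)}, x^{1/2}]`, parameters in range, and every `j ≥ 1`,
`|Σ_{q ≤ x, Ω(q)=2, P⁻(q)>z} a_q I_j(log(x/P⁻(q))/log P⁻(q)) − I_{j+1}(u') (2T − Σ_{z<p≤x} a_p)| ≤ kernelErr`,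
`T = primeMain 𝒜 x z`, `u' = log x/log z`. This is Bombieri's `P₂` law ([BombieriRIMS1977] p. 5, `r = 2`:
`Σ a_{pq} G(log p/log pq) + (∫G dμ₂) Σ a_p − 2 (∫G dμ₂) H A/log x = o(A/log x)`) for the Buchstab test functions
`G = I_j((1-β)/β) 1_{β>1/u'}` (`∫ G dμ₂ = I_{j+1}(u')`, `roughCellDensity_succ`), made effective — polynomial
rate `η^κ` in the level deficit — and uniform over the admissible class. Printed technology (Friedlander–Iwaniec
1978 §4 vector `Λ_(k)` laws at finite level + the moments `Q_m` of the tree's `BombieriAsymptoticSievePr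
DistributionProofs` + Weierstrass) gives the law with a logarithmic rate only. A research statement, not a fact. -/
def EffectiveWeightedP2Law : Prop :=
  ∀ (u : ℕ) (A₁ L' : ℝ), 2 ≤ u → ∃ (κ C η₀ : ℝ) (A₂ : ℕ) (x₀ : ℝ), 0 < κ ∧ 0 ≤ C ∧ 0 < η₀ ∧
    ∀ (𝒜 : SieveSequence) (x z η Λ w₀ R : ℝ), x₀ ≤ x →
      x ^ (1 / ((u : ℝ) + 1)) ≤ z → z ≤ x ^ (1 / 2 : ℝ) →
      KernelRanges x η Λ w₀ η₀ → KernelAdmissible A₁ L' 𝒜 x η Λ w₀ R →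
      ∀ j : ℕ, 1 ≤ j →
        |weightedPairSum 𝒜 x z j -
            roughCellDensity (j + 1) (Real.log x / Real.log z) *
              (2 * primeMain 𝒜 x z - roughCellSum 𝒜 x z 1)|
          ≤ kernelErr C κ A₂ 𝒜 x z η Λ R

/-! ## Provable inputs of the induction -/

/-- **Linear-sieve upper bound for the primes of the sequence** (`PrimeUpperBound`; type of `stub_primeUpperBound`):
`Σ_{z<p≤x} a_p ≤ 2T + C(η^κ + (log z)^{-κ} + log(2Λ)/log z) V(z)A + C(log x)^{A₂}(R + x/z)` for admissible data
(Iwaniec's linear sieve at `s = 2(1−η)`, `F(s) = 2e^γ/s`, error `(log y)^{-1/3}` — so `κ = 1/3` works —, sifting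
the support `(x/Λ, x]`, which contains no prime `≤ x^{1/2}`, by the primes `< x^{1/2}` at level `y = x^{1−η}`;
the two-sided Mertens bounds convert `V(x^{1/2})` into `V(z)·2/u'`). Bombieri's `δ_x ≤ 2`. -/
def PrimeUpperBound : Prop :=
  ∀ (u : ℕ) (A₁ L' : ℝ), 2 ≤ u → ∃ (κ C η₀ : ℝ) (A₂ : ℕ) (x₀ : ℝ), 0 < κ ∧ 0 ≤ C ∧ 0 < η₀ ∧
    ∀ (𝒜 : SieveSequence) (x z η Λ w₀ R : ℝ), x₀ ≤ x →
      x ^ (1 / ((u : ℝ) + 1)) ≤ z → z ≤ x ^ (1 / 2 : ℝ) →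
      KernelRanges x η Λ w₀ η₀ → KernelAdmissible A₁ L' 𝒜 x η Λ w₀ R →
      roughCellSum 𝒜 x z 1 ≤ 2 * primeMain 𝒜 x z + kernelErr C κ A₂ 𝒜 x z η Λ R

/-- **The Buchstab recursion for rough cells** (`RecursionIdentity`; proved with the induction): sorting a rough
`q` with `Ω(q) = j+1 ≥ 2` by its least prime factor `p = P⁻(q) > z` is a bijection onto the pairs `(p, m)`,
`m = q/p ≤ x/p`, `Ω(m) = j`, `P⁻(m) ≥ p` (i.e. `> p − 1/2`): `C_{j+1}(𝒜; x, z) = Σ_{z<p≤x} C_j(𝒜_p; x/p, p − 1/2)`.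
Exact; no hypothesis on the sequence. -/
def RecursionIdentity : Prop :=
  ∀ (𝒜 : SieveSequence) (x z : ℝ) (j : ℕ), 1 ≤ j → 0 ≤ z →
    roughCellSum 𝒜 x z (j + 1) =
      ∑ p ∈ (Finset.Ioc 0 ⌊x⌋₊).filter (fun p : ℕ => p.Prime ∧ z < (p : ℝ)),
        roughCellSum (fibreSeq 𝒜 p) (x / p) ((p : ℝ) - 1 / 2) j

/-- **Fibres of admissible data are admissible on average** (`FibreInheritance`; type of `stub_fibreInheritance`):
for admissible `(𝒜, x, η, Λ, w₀, R)` there are fibre Type-I bounds `R_p ≥ 0` with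
`Σ_{z<p≤x} R_p ≤ C (log x)^{A₃} (R + x/z)` such that for every prime `z < p ≤ x^{1/2}` the fibre `𝒜_p` is
admissible at `(x/p, η_p, Λ, w₀, R_p)`, `η_p = η log x/log(x/p)` (so that `(x/p)^{1−η_p} = x^{1−η}/p`). The
remainder of `𝒜_p` at a modulus `d'` coprime to `p` and truncation `y'` is `r_{pd'}(py') − g(d') r_p(py')`;
moduli `p ∣ d'` are junk `≪ x(log x)^{A₃}/p²`; `Σ_p Σ_{d'} sup |r_{pd'}| ≤ (max ω) Σ_d sup |r_d|`. -/
def FibreInheritance : Prop :=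
  ∀ (A₁ L' : ℝ), ∃ (C : ℝ) (A₃ : ℕ), 0 ≤ C ∧ ∀ (𝒜 : SieveSequence) (x z η Λ w₀ R : ℝ),
    2 ≤ x → 1 ≤ z → 0 < η → η ≤ 1 / 2 → 0 ≤ R → KernelAdmissible A₁ L' 𝒜 x η Λ w₀ R →
    ∃ Rp : ℕ → ℝ, (∀ p, 0 ≤ Rp p) ∧
      (∑ p ∈ (Finset.Ioc 0 ⌊x⌋₊).filter (fun p : ℕ => p.Prime ∧ z < (p : ℝ)), Rp p ≤
          C * Real.log x ^ A₃ * (R + x / z)) ∧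
      ∀ p : ℕ, p.Prime → z < (p : ℝ) → (p : ℝ) ≤ x ^ (1 / 2 : ℝ) →
        KernelAdmissible A₁ L' (fibreSeq 𝒜 p) (x / p) (η * Real.log x / Real.log (x / p)) Λ w₀ (Rp p)

/-- **The model prime sum with rate** (`ModelPrimeSum`; type of `stub_modelPrimeSum`): for admissible data and
`m ≥ 1`, the fibres' `m`-cell models at the fibres' own prime scales add up to the parent's `(m+1)`-cell model:
`|Σ_{z<p≤x} I_m(u_p) e^γ V(p) A_p(x)/u_p − I_{m+1}(u') T(𝒜; x, z)| ≤ C (log z)⁻¹ V(z) A(x) + C R`,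
`u_p = log(x/p)/log p`, `V(p) = ∏_{q<p}(1 − g(q))`, `A_p(x) = Σ_{n ≤ x, p ∣ n} a_n = g(p)A(x) + r_p(x)`
(summands with `p > x^{1/2}` vanish: `u_p < 1 ≤ m`). Proof route: `A_p = g(p)A + r_p` with `Σ|r_p| ≤ R` and
`I_m(u)/u ≤ 1`; `g(p)V(p) = V(p) − V(p⁺)` telescopes, so the main sum is a Stieltjes/Abel sum of the bounded,
bounded-variation weight `Φ(v) = I_m(u_v)/u_v` against the step function `V`; the two-sided Mertens evaluation
`V(v) = V(z)(log z/log v)(1 ± 3L'/log z)` (`z ≥ w₀`) and `∫_z Φ(v) log z dv/(v log² v)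
= (1/u')∫_{1/u'}^{1/2} I_m((1−β)/β) dβ/(β(1−β)) = I_{m+1}(u')/u'` (`t = (1−β)/β`, `roughCellDensity_succ`). -/
def ModelPrimeSum : Prop :=
  ∀ (u : ℕ) (A₁ L' : ℝ), 2 ≤ u → ∃ (C : ℝ) (x₀ : ℝ), 0 ≤ C ∧
    ∀ (𝒜 : SieveSequence) (x z η Λ w₀ R : ℝ), x₀ ≤ x →
      x ^ (1 / ((u : ℝ) + 1)) ≤ z → z ≤ x ^ (1 / 2 : ℝ) →
      KernelRanges x η Λ w₀ (1 / (4 * (u : ℝ))) → KernelAdmissible A₁ L' 𝒜 x η Λ w₀ R →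
      ∀ m : ℕ, 1 ≤ m →
        |(∑ p ∈ (Finset.Ioc 0 ⌊x⌋₊).filter (fun p : ℕ => p.Prime ∧ z < (p : ℝ)),
            roughCellDensity m (Real.log (x / p) / Real.log p) *
              (Real.exp Real.eulerMascheroniConstant * 𝒜.densityProduct (primesProdBelow p) *
                𝒜.congrSum p x / (Real.log (x / p) / Real.log p))) -
          roughCellDensity (m + 1) (Real.log x / Real.log z) * primeMain 𝒜 x z|
          ≤ C * (Real.log z)⁻¹ * (𝒜.densityProduct (primesProdBelow z) * 𝒜.size x) + C * R

/-- **The induction** (`KernelInduction`; type of `stub_kernelInduction`, held by the lead): the four provable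
inputs (upper bound, recursion, fibre inheritance, model sum) and the weighted `P₂` law give the strong rough-cell law, by induction on `m` along the Buchstab recursion
(`δ := 2 − C₁/T` clipped to `[0,2]` by `PrimeUpperBound`; step:
`C_{m+1} = S_T + (−1)^m (S_T − S_π)` with `S_T` the model prime sum and `S_π` the weighted pair sum). -/
def KernelInduction : Prop :=
  PrimeUpperBound → RecursionIdentity → FibreInheritance → ModelPrimeSum → EffectiveWeightedP2Law →
    EffectiveRoughCellLawStrong

/-! ## Crux-side glue for the strong kernel -/

/-- **Covering inequality** (`CoveringInequality`; consumed by `GeThreeReduceStrong`): for weights in `[0,1]`,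
counting-function size and a density with `g(p) ≤ A₁/p` of Iwaniec dimension `Ω(1, L')`, the strong Type-I sum is
controlled by the body-by-body one on a grid of `⌈Y⌉ + 1 ≤ Y + 2` truncations `k x/⌈Y⌉`: for every selection
`y_d ≤ x`, `Σ_{d ≤ x^{1−η} sqfree} |r_d(y_d)| ≤ (Y + 2) sup_{y ≤ x} Σ_d |r_d(y)| + C (x/Y + x^{1−η}) (log x)^{A₃}`
(rounding `y_d` down to the grid moves `r_d` by at most `(x/Y)(1/d + g(d)) + 1 + g(d)`, and
`Σ_{d ≤ D sqfree} g(d) ≤ ∏_{p ≤ D}(1 + g(p)) ≤ ∏_{2 ≤ p < D+1}(1 − g(p))⁻¹ ≤ (log(D+1)/log 2)(1 + L'/log 2)`;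
`r_d(y) = r_d(⌊y⌋₊)` and `r_d(y) = 0` for `y < 0`). -/
def CoveringInequality : Prop :=
  ∀ (A₁ L' : ℝ), ∃ (C : ℝ) (A₃ : ℕ), 0 ≤ C ∧ ∀ (𝒜 : SieveSequence) (x η Rw Y : ℝ), 2 ≤ x → 0 ≤ η → 1 ≤ Y →
    (∀ q : ℕ, 𝒜.a q ≤ 1) → (∀ y : ℝ, 𝒜.size y = 𝒜.congrSum 1 y) →
    (∀ p : ℕ, p.Prime → 𝒜.density p ≤ A₁ / p) → HasIwaniecDimension 𝒜.density 1 L' →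
    (∀ y : ℝ, y ≤ x → ∑ d ∈ (Finset.Icc 1 ⌊x ^ (1 - η)⌋₊).filter Squarefree, |𝒜.remainder d y| ≤ Rw) →
    StrongTypeI 𝒜 x η ((Y + 2) * Rw + C * (x / Y + x ^ (1 - η)) * Real.log x ^ A₃)

/-- **The strong kernel applied** (`GeThreeReduceStrong`; type of `stub_geThreeReduceStrong`): the analogue of the
landed `GeThreeReduce` with `EffectiveRoughCellLawStrong` in place of `EffectiveRoughCellLaw` (and the covering
inequality as an input) — the ready section
sequence (`KernelReadyAt`, landed `stub_geThreeHyp`) supplies the body-by-body Type-I bound `N/(log N)^A` for every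
`A`; `CoveringInequality` with `Y = (log N)^{A/2}` turns it into a strong bound `≪ N/(log N)^{A/2 − A₃ − 1}
+ x^{1−η}(log x)^{A₃}` (`etaOf N B₂ ≤ η₀` eventually), and for `N ≥ N₀` the strong kernel's error is below `V F/(log log N)^{Bκ} + N/log^{t+2} N`
exactly as in `GeThreeReduce` (the junk `x/z = 2LN^{1−1/u}` and `x^{1−η} = (2LN)^{1−2(log log N)^{−B₂}}` are
eventually below every `N/(log N)^{A'}`). -/
def GeThreeReduceStrong : Prop :=
  CoveringInequality → EffectiveRoughCellLawStrong → (∀ t : ℕ, 1 ≤ t → SectionLevelAt t → KernelReadyAt t) →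
    ∀ t : ℕ, 1 ≤ t → SectionLevelAt t → RawSectionLawAt t

/-- **The composition of the `u ≥ 3` rung through the strong kernel** (`GeThreeComposeStrongStep`; type of the
bookkeeping stub `stub_geThreeComposeStrong`, the analogue of `GeThreeComposeStep` with the reshaped kernel inputs
and `GeThreeReduceStrong`): pure logic. -/
def GeThreeComposeStrongStep : Prop :=
  PrimeUpperBound → RecursionIdentity → FibreInheritance → ModelPrimeSum → EffectiveWeightedP2Law →
    KernelInduction → CoveringInequality →
    SectionSeqBFacts → SectionSeqBCells → SectionDimension → SectionDimensionLow →
    SectionMertensLowerHead → (SectionMertensLowerHead → SectionMertensTwo) → ModelDensityAlladi →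
      PrLawTwoPrep → EulerRatioIdentity → GeThreeHyp → GeThreeReduceStrong → GeThreeMainTerm → GeThreeAssembly →
        ∀ t : ℕ, 1 ≤ t → SectionLevelAt t → ∀ u : ℕ, 3 ≤ u → SectionPrLawAtU u t

/-- **`stub_geThreeComposeStrong`** (registered bookkeeping stub of skeleton v18; pure logic): the reshaped kernel
inputs give the strong kernel (`KernelInduction`), which the strong reduction and the landed glue turn into
`stub_prLawGeThree`'s statement exactly as `stub_geThreeCompose` does. -/
theorem stub_geThreeComposeStrong : GeThreeComposeStrongStep :=
  fun hU hRec hFib hMod hP2 hInd hCov hF hC hD hDl hLH hM2 hA hP hE hHyp hRed hMT hAsm =>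
    hAsm hF hC (hMT (hM2 hLH) hA) hP hE (hRed hCov (hInd hU hRec hFib hMod hP2) (hHyp hF hC hD hDl))

end Summit.Parity.GeneralizedHardyLittlewood.Cruxes.CellParityLaw.SectionAnnihilator

end
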